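import Literature.MathematicalPhysics.QuantumFieldTheory.Balaban1983to89.Node00.Record13SepCoPInhabitedOfThm1CoP7M
import Literature.MathematicalPhysics.QuantumFieldTheory.Balaban1983to89.Node00.Record12BgRowCoClassC1B

/-!
# NODE 00 (YM-PLAN Track A) — STAGE 13, v1.5 `CoP`: THE K0 CLOSERS AT `θ₁₅ᶜᶜ¹` FROM **BOTH** GUARDED [15] SENTENCES OVER PRINT's (2.3) DATUM — (8) `VariationalThm1RegSepCoP7MGB F N Adm (lamDatum F)
# (dataSmall7PTopOf F N) B₃ a₀ a₁` AND (9)–(10) `VariationalThm1C1RegSepCoP7MGB F N Adm (lamDatum F) (dataSmall7PTopOf F N) B₃ B₃' a₀ a₁` (node00-def-K0a's additive leaf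
# `Record12BgRowCoClassC1B`: the gauge-invariant C¹ reading over a bond datum, a top-data predicate and a prefix guard) — 16c ★★★★★ with its guarded C¹ clause DISCHARGED from the
# second sentence; no displayed class clause

Cell `pub-ymgap`, seat `pub-ymgap-node00-def-K0a` (g7: FILE 16d, the (β)-form of plan's Cut B; g10: STAGE-2 RE-KEY).  [15] = [Balaban1985Variational], [6] = [Balaban1985RegularSpaces],
[II] = [Balaban1984PropagatorsII], [III] = [Balaban1988Convergent], [I] = [Balaban1987RG1].

STAGE-2 RE-KEY (2026-08-30; (E1) variant (iii-b) of record, director-ym №343 (D5)∕(D6), №345, №350; seat node00-def-K0a g10): «(E1) Stage-2 coherence re-key to print's (2.3) datum (FLAG №16 ∕ LOCATE-HSEAM 5d3298b8d191f169); the (b)-keyed text survives in git history».  After the `Record13CoP` seam re-point `UbgOfRecord₁₃CoP (n+1) = UbgMSCoPOfRecordB …` (node00-def-R) every hypothesis of this file is READ AT PRINT's DATUM, token for token: (9)–(10) `VariationalThm1C1RegSepCoP7M F N B₃ B₃' a₀ a₁` ↦ `VariationalThm1C1RegSepCoP7MGB F N Adm (lamDatum F) (dataSmall7PTopOf F N)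 B₃ B₃' a₀ a₁`
(the additive ᴮ twin `Record12BgRowCoClassC1B`, same `(Adm, bd, Dat)` as S1a-C∕S1b-2 — ONE guard `Adm` and ONE displayed discharge `hAdm` serve (8) and (9)–(10)); (8) as in 16c; clause tokens
`solvableDomB … (lamBondsSeq s.Ω n)` ∕ `UbgMSCoPOfRecordB`; node00-def-P11's record-level supplier `plaqC1SmallOn_UbgMSCoPOfRecord_of_thm1C1RegSepCoP7M` ↦ C1B's pointwise
`plaqC1SmallOn_of_thm1C1RegSepTop7MGB` ∘ `isMinimizerB_UbgMSCoPOfRecordB` (S2b), two terms inlined.  Every declaration NAME and conclusion SHAPE unchanged; 16c's re-keyed closers consumed by name.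

WHAT THIS FILE PROVES (theorems only; 0 `def`).
* ★★★ `classC1CoP_theta13OfThm1CC1_of_thm1C1RegSepCoP7M (hB hB' ha₀ ha₁) (h15C1) (hAdm) (hmono) (hcompRev)` — 16c's HYPOTHESIS `hclassC1` (the guarded C¹ clause: scales `1 ≤ m ≤ n`, plaquette
  pairs inside `Ω_m`, at `UbgMSCoPOfRecordB` on print's solvable set) over the v1.5 range AT `θ₁₅ᶜᶜ¹`, from the C¹ sentence + its guard at the witness family + the two history clauses.
* ★★★★★ `exists_k0SepCoP_of_thm1RegSepCoP7M_of_thm1C1 (F) (signs) (h15) (h15C1) (hAdm) (hmono) (hcompRev)` — the v1.5 K0 body for `F` at `N = 2`; NO displayed class clause.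
* ★★★★★★ `exists_k0SepCoP_of_thm1RegSepCoP7M_of_thm1C1_of_betaBox (F) (signs) (h15) (h15C1) (hAdm) (hb) (hlow) (hup) (hβ′)` — both history clauses from the β-box leaf (13e ∕ 14d): plan's Cut B
  with (i) the two guarded sentences over print's datum + `hAdm`, (ii) the β-box leaf, (iii) the signs; NO class clause, NO C¹ letter, NO axial letter.

HONEST FRAMING.  Compositions of tree theorems; CONDITIONAL on the TWO displayed named facts (`Prop`s with parameters, NEVER asserted), their guard's discharge `hAdm` and the β-box ∕ history
clauses; nothing of Bałaban asserted; NOT a discharge; K0 NOT closed here; counts unmoved (typed 28∕28 · discharged 8∕28); one finite 𝕋⁴ programme at fixed ε — NOT continuum ∕ OS ∕ mass gap ∕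
Clay.  No `sorry`, `axiom`, `def`, `instance`, `notation`.
-/

noncomputable section

open MeasureTheory
open scoped Matrix.Norms.L2Operator

namespace Literature.MathematicalPhysics.QuantumFieldTheory.Balaban1983to89.Node00

open T4Continuum B14.Eq218Concrete B15DeterminingSets B15DeterminingSetsB B12RegularSpaces111 B14RegularSpaces234 B14Radii T4AxialGaugeSmallField

/-! ## Plan's Cut B under v1.5 `CoP` AT PRINT's DATUM, BOTH class clauses from NAMED FACTS: the guarded C¹ clause AT `θ₁₅ᶜᶜ¹` FROM `VariationalThm1C1RegSepCoP7MGB … (lamDatum F) …`; the K0 body -/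

section FromBothFactsSepCoP

variable {F : T4Family} {N : ℕ} [NeZero N] {ε₀ ε₂₉ B₃ B₃' a₀ a₁ : ℝ}

/-- **★★★ THE GUARDED C¹ CLASS CLAUSE (scales `1 ≤ m ≤ n`, plaquette pairs INSIDE `Ω_m`, on the solvable set of PRINT's DATUM) OVER THE v1.5 RANGE AT `θ₁₅ᶜᶜ¹` FROM THE GUARDED C¹ SENTENCE
`VariationalThm1C1RegSepCoP7MGB F N Adm (lamDatum F) (dataSmall7PTopOf F N) B₃ B₃' a₀ a₁`** (the gauge-invariant reading of [15] Thm 1 (9)–(10) for minimisers over print's class (6) ON THE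
SUPPORT DOMAIN determined on [II] (2.3)'s bond datum `lamBondsSeq s.Ω n`, thresholds comparable both ways, `0 < M₁`, prefix guard `Adm` — NEVER asserted), **ITS GUARD AT THE WITNESS FAMILY
(`hAdm`) AND THE TWO HISTORY CLAUSES** (hmono ⇒ `ε_m ≤ 2ε_{m+1}`; hcompRev): C1B's pointwise accessor `plaqC1SmallOn_of_thm1C1RegSepTop7MGB` at node00-def-R's print-datum background through
`isMinimizerB_UbgMSCoPOfRecordB … hsol` (S2b), fed with 13c's `hnum_theta13OfThm1CC1` ∕ `εreg_le_theta13OfThm1CC1` ∕ `hcomp_theta13OfThm1CC1_of_monotone` and `theta13OfThm1CC1_M₁` (`M₁ = 1`).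
Its statement is 16c's hypothesis `hclassC1` VERBATIM (generic `N`).  CONDITIONAL; nothing of Bałaban asserted. [cite: Balaban1985Variational, (6)–(7) p.278, Thm 1 (2),(9)–(10) p.279, p.304 lines 1–2; Balaban1985RegularSpaces, (1.3)–(1.9) p.77; Balaban1984PropagatorsII, (2.3) p.224; Balaban1988Convergent, (2.4)–(2.8) pp.255–256, (2.10) p.256, (2.12)–(2.13) p.256, (2.38) p.261] -/
theorem classC1CoP_theta13OfThm1CC1_of_thm1C1RegSepCoP7M (hB : 0 ≤ B₃) (hB' : 0 ≤ B₃') (ha₀ : 0 < a₀) (ha₁ : 0 < a₁) {Adm : StepGuard F}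
    (h15C1 : VariationalThm1C1RegSepCoP7MGB F N Adm (lamDatum F) (dataSmall7PTopOf F N) B₃ B₃' a₀ a₁)
    (hAdm : ∀ (p : B12.RunParams) (n : ℕ) (s : SeqOfRecord F (theta13OfThm1CC1 F N ε₀ ε₂₉ B₃ B₃' a₀ a₁).ν (theta13OfThm1CC1 F N ε₀ ε₂₉ B₃ B₃' a₀ a₁).τ9.M (gOfRecord₁₃ F N (theta13OfThm1CC1 F N ε₀ ε₂₉ B₃ B₃' a₀ a₁) p) p.K n), 1 ≤ n → n ≤ p.K →
      Step.InInterval (theta13OfThm1CC1 F N ε₀ ε₂₉ B₃ B₃' a₀ a₁).γ n (gOfRecord₁₃ F N (theta13OfThm1CC1 F N ε₀ ε₂₉ B₃ B₃' a₀ a₁) p) → PartCompat₁₃ F N (theta13OfThm1CC1 F N ε₀ ε₂₉ B₃ B₃' a₀ a₁) p n → Adm (theta13OfThm1CC1 F N ε₀ ε₂₉ B₃ B₃' a₀ a₁).ν (theta13OfThm1CC1 F N ε₀ ε₂₉ B₃ B₃' a₀ a₁).τ9.M (gOfRecord₁₃ F N (theta13OfThm1CC1 F N ε₀ ε₂₉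 B₃ B₃' a₀ a₁) p) p.K n s)
    (hmono : ∀ (p : B12.RunParams) (n : ℕ), n ≤ p.K → Step.InInterval (theta13OfThm1CC1 F N ε₀ ε₂₉ B₃ B₃' a₀ a₁).γ n (gOfRecord₁₃ F N (theta13OfThm1CC1 F N ε₀ ε₂₉ B₃ B₃' a₀ a₁) p) → ∀ m, m < n →
      gOfRecord₁₃ F N (theta13OfThm1CC1 F N ε₀ ε₂₉ B₃ B₃' a₀ a₁) p m ≤ gOfRecord₁₃ F N (theta13OfThm1CC1 F N ε₀ ε₂₉ B₃ B₃' a₀ a₁) p (m + 1))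
    (hcompRev : ∀ (p : B12.RunParams) (n : ℕ), n ≤ p.K → Step.InInterval (theta13OfThm1CC1 F N ε₀ ε₂₉ B₃ B₃' a₀ a₁).γ n (gOfRecord₁₃ F N (theta13OfThm1CC1 F N ε₀ ε₂₉ B₃ B₃' a₀ a₁) p) → ∀ m, m < n →
      (theta13OfThm1CC1 F N ε₀ ε₂₉ B₃ B₃' a₀ a₁).s2.cR * epsOfRecord (theta13OfThm1CC1 F N ε₀ ε₂₉ B₃ B₃' a₀ a₁).ν (gOfRecord₁₃ F N (theta13OfThm1CC1 F N ε₀ ε₂₉ B₃ B₃' a₀ a₁) p) (m + 1) ≤ 2 * ((theta13OfThm1CC1 F N ε₀ ε₂₉ B₃ B₃' a₀ a₁).s2.cR * epsOfRecord (theta13OfThm1CC1 F N ε₀ ε₂₉ B₃ B₃' a₀ a₁).ν (gOfRecord₁₃ F N (theta13OfThm1CC1 F N ε₀ ε₂₉ B₃ B₃' a₀ a₁) p) m)) :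
    ∀ (p : B12.RunParams) (n : ℕ), n ≤ p.K → Step.InInterval (theta13OfThm1CC1 F N ε₀ ε₂₉ B₃ B₃' a₀ a₁).γ n (gOfRecord₁₃ F N (theta13OfThm1CC1 F N ε₀ ε₂₉ B₃ B₃' a₀ a₁) p) → PartCompat₁₃ F N (theta13OfThm1CC1 F N ε₀ ε₂₉ B₃ B₃' a₀ a₁) p n →
    ∀ s : SeqOfRecord F (theta13OfThm1CC1 F N ε₀ ε₂₉ B₃ B₃' a₀ a₁).ν (theta13OfThm1CC1 F N ε₀ ε₂₉ B₃ B₃' a₀ a₁).τ9.M (gOfRecord₁₃ F N (theta13OfThm1CC1 F N ε₀ ε₂₉ B₃ B₃' a₀ a₁) p) p.K n, Sect2.SeqSeparated (theta13OfThm1CC1 F N ε₀ ε₂₉ B₃ B₃' a₀ a₁).ν.M₁ s → ∀ W : MSField (F.P p.K) (SU N),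
    W ∈ suppOfRecord₁₃P F N (theta13OfThm1CC1 F N ε₀ ε₂₉ B₃ B₃' a₀ a₁) p n s → Sect2.DataSmall7PTop (avOfRecord F N p.K) s.Ω (suppDomOfRecord F (theta13OfThm1CC1 F N ε₀ ε₂₉ B₃ B₃' a₀ a₁).ν p.K s.Ω) n (fun j => (theta13OfThm1CC1 F N ε₀ ε₂₉ B₃ B₃' a₀ a₁).s2.cR * epsOfRecord (theta13OfThm1CC1 F N ε₀ ε₂₉ B₃ B₃' a₀ a₁).ν (gOfRecord₁₃ F N (theta13OfThm1CC1 F N ε₀ ε₂₉ B₃ B₃' a₀ a₁) p) j) W →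
    W ∈ solvableDomB (avOfRecord F N p.K) (regMSCoPOfRecord F N (theta13OfThm1CC1 F N ε₀ ε₂₉ B₃ B₃' a₀ a₁).ν p.K n s.Ω) (lamBondsSeq s.Ω n) →
    ∀ m, 1 ≤ m → m ≤ n → PlaqC1SmallOn (plaqInside (s.Ω m)) (B₃' * ((theta13OfThm1CC1 F N ε₀ ε₂₉ B₃ B₃' a₀ a₁).s2.cR * epsOfRecord (theta13OfThm1CC1 F N ε₀ ε₂₉ B₃ B₃' a₀ a₁).ν (gOfRecord₁₃ F N (theta13OfThm1CC1 F N ε₀ ε₂₉ B₃ B₃' a₀ a₁) p) m) * (F.P p.K).eta m ^ 3)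
    (UbgMSCoPOfRecordB F N (theta13OfThm1CC1 F N ε₀ ε₂₉ B₃ B₃' a₀ a₁).ν (theta13OfThm1CC1 F N ε₀ ε₂₉ B₃ B₃' a₀ a₁).τ9.M (gOfRecord₁₃ F N (theta13OfThm1CC1 F N ε₀ ε₂₉ B₃ B₃' a₀ a₁) p) p.K n s W) := by
  intro p n hn hw hpc s hsep W _ h7 hsol m h1 hm
  exact plaqC1SmallOn_of_thm1C1RegSepTop7MGB h15C1 (theta13OfThm1CC1 F N ε₀ ε₂₉ B₃ B₃' a₀ a₁).ν (theta13OfThm1CC1 F N ε₀ ε₂₉ B₃ B₃' a₀ a₁).τ9.M (gOfRecord₁₃ F N (theta13OfThm1CC1 F N ε₀ ε₂₉ B₃ B₃' a₀ a₁) p) p.K n (theta13OfThm1CC1 F N ε₀ ε₂₉ B₃ B₃' a₀ a₁).s2.cR s hsep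
    (by rw [theta13OfThm1CC1_M₁]; exact Nat.one_pos) (hAdm p n s (h1.trans hm) hn hw hpc) (hnum_theta13OfThm1CC1 hB hB' ha₀ ha₁ p n hn hw) εreg_le_theta13OfThm1CC1
    (hcomp_theta13OfThm1CC1_of_monotone hB hB' ha₀.le ha₁.le hmono p n hn hw) (hcompRev p n hn hw) h7
    (isMinimizerB_UbgMSCoPOfRecordB (theta13OfThm1CC1 F N ε₀ ε₂₉ B₃ B₃' a₀ a₁).ν (theta13OfThm1CC1 F N ε₀ ε₂₉ B₃ B₃' a₀ a₁).τ9.M (gOfRecord₁₃ F N (theta13OfThm1CC1 F N ε₀ ε₂₉ B₃ B₃' a₀ a₁) p) p.K n s hsol) m h1 hm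

/-- **★★★★★ THE v1.5 K0 BODY FOR `F` AT `N = 2` FROM THE TWO GUARDED [15]-FACT INSTANCES OVER PRINT's DATUM — (8) `VariationalThm1RegSepCoP7MGB F 2 Adm (lamDatum F) (dataSmall7PTopOf F 2) B₃ a₀ a₁`
AND (9)–(10) `VariationalThm1C1RegSepCoP7MGB F 2 Adm (lamDatum F) (dataSmall7PTopOf F 2) B₃ B₃' a₀ a₁` — THEIR COMMON GUARD AT THE WITNESS FAMILY (`hAdm`) AND THE TWO HISTORY CLAUSES; NO
displayed class clause**: FILE 16c ★★★★★ `exists_k0SepCoP_of_thm1RegSepCoP7M` with `hclassC1 := ★★★`.  CONDITIONAL — nothing of Bałaban asserted; K0 NOT closed here. [cite: Balaban1985Variational, (6)–(7) p.278, Thm 1 (8)–(10) p.279, p.304 lines 1–2; Balaban1985RegularSpaces, (1.3)–(1.9) p.77; Balaban1984PropagatorsII, (2.3) p.224; Balaban1988Convergent, Thm 1 p.262, (2.4)–(2.8) pp.255–256, (2.10) p.256, (2.12)–(2.13) p.256, (2.27)–(2.28) p.259, (2.34)–(2.41) p.261, (3.16)–(3.22) pp.268–269; Balaban1989LargeFieldI,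 (0.3)–(0.4) p.176] -/
theorem exists_k0SepCoP_of_thm1RegSepCoP7M_of_thm1C1 (F : T4Family) (hε : 0 < ε₀) (hε' : 0 < ε₂₉) (hB : 0 ≤ B₃) (hB' : 0 ≤ B₃') (ha₀ : 0 < a₀) (ha₁ : 0 < a₁) {Adm : StepGuard F}
    (h15 : VariationalThm1RegSepCoP7MGB F 2 Adm (lamDatum F) (dataSmall7PTopOf F 2) B₃ a₀ a₁) (h15C1 : VariationalThm1C1RegSepCoP7MGB F 2 Adm (lamDatum F) (dataSmall7PTopOf F 2) B₃ B₃' a₀ a₁)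
    (hAdm : ∀ (p : B12.RunParams) (n : ℕ) (s : SeqOfRecord F (theta13OfThm1CC1 F 2 ε₀ ε₂₉ B₃ B₃' a₀ a₁).ν (theta13OfThm1CC1 F 2 ε₀ ε₂₉ B₃ B₃' a₀ a₁).τ9.M (gOfRecord₁₃ F 2 (theta13OfThm1CC1 F 2 ε₀ ε₂₉ B₃ B₃' a₀ a₁) p) p.K n), 1 ≤ n → n ≤ p.K →
      Step.InInterval (theta13OfThm1CC1 F 2 ε₀ ε₂₉ B₃ B₃' a₀ a₁).γ n (gOfRecord₁₃ F 2 (theta13OfThm1CC1 F 2 ε₀ ε₂₉ B₃ B₃' a₀ a₁) p) → PartCompat₁₃ F 2 (theta13OfThm1CC1 F 2 ε₀ ε₂₉ B₃ B₃' a₀ a₁) p n → Adm (theta13OfThm1CC1 F 2 ε₀ ε₂₉ B₃ B₃' a₀ a₁).ν (theta13OfThm1CC1 F 2 ε₀ ε₂₉ B₃ B₃' a₀ a₁).τ9.M (gOfRecord₁₃ F 2 (theta13OfThm1CC1 F 2 ε₀ ε₂₉ B₃ B₃' a₀ a₁) p) p.K n s)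
    (hmono : ∀ (p : B12.RunParams) (n : ℕ), n ≤ p.K → Step.InInterval (theta13OfThm1CC1 F 2 ε₀ ε₂₉ B₃ B₃' a₀ a₁).γ n (gOfRecord₁₃ F 2 (theta13OfThm1CC1 F 2 ε₀ ε₂₉ B₃ B₃' a₀ a₁) p) → ∀ m, m < n →
      gOfRecord₁₃ F 2 (theta13OfThm1CC1 F 2 ε₀ ε₂₉ B₃ B₃' a₀ a₁) p m ≤ gOfRecord₁₃ F 2 (theta13OfThm1CC1 F 2 ε₀ ε₂₉ B₃ B₃' a₀ a₁) p (m + 1))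
    (hcompRev : ∀ (p : B12.RunParams) (n : ℕ), n ≤ p.K → Step.InInterval (theta13OfThm1CC1 F 2 ε₀ ε₂₉ B₃ B₃' a₀ a₁).γ n (gOfRecord₁₃ F 2 (theta13OfThm1CC1 F 2 ε₀ ε₂₉ B₃ B₃' a₀ a₁) p) → ∀ m, m < n →
      (theta13OfThm1CC1 F 2 ε₀ ε₂₉ B₃ B₃' a₀ a₁).s2.cR * epsOfRecord (theta13OfThm1CC1 F 2 ε₀ ε₂₉ B₃ B₃' a₀ a₁).ν (gOfRecord₁₃ F 2 (theta13OfThm1CC1 F 2 ε₀ ε₂₉ B₃ B₃' a₀ a₁) p) (m + 1) ≤ 2 * ((theta13OfThm1CC1 F 2 ε₀ ε₂₉ B₃ B₃' a₀ a₁).s2.cR * epsOfRecord (theta13OfThm1CC1 F 2 ε₀ ε₂₉ B₃ B₃' a₀ a₁).ν (gOfRecord₁₃ F 2 (theta13OfThm1CC1 F 2 ε₀ ε₂₉ B₃ B₃' a₀ a₁) p) m)) :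
    ∃ θ : Stage13Params F 2, θ.Provisos₁₃SepCoP F 2 ∧ (θ.ZtUnity F 2 ∧ θ.SlotsNondegenerate₁₃ F 2) ∧ θ.Admissible F 2 :=
  exists_k0SepCoP_of_thm1RegSepCoP7M F hε hε' hB hB' ha₀ ha₁ h15 hAdm hmono hcompRev
    (classC1CoP_theta13OfThm1CC1_of_thm1C1RegSepCoP7M hB hB' ha₀ ha₁ h15C1 hAdm hmono hcompRev)

/-- **★★★★★★ THE v1.5 K0 BODY FOR `F` FROM THE TWO GUARDED FACT INSTANCES OVER PRINT's DATUM, THEIR GUARD AT THE WITNESS FAMILY AND THE β-BOX LEAF; NO displayed class clause** — both history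
clauses from `FlowStep.BetaLowerH b ½ (betaOfRecord₁₃ F 2 θ₁₅ᶜᶜ¹)`, `0 ≤ b` (13e) and `FlowStep.BetaUpperH β′ ½ (betaOfRecord₁₃ F 2 θ₁₅ᶜᶜ¹)`, `β′ ≤ 3` (14d): plan's Cut B = (i) the (8)-sentence
([15] Thm 1 (8); ⟸ [15] Prop 8's top step over the same `(Adm, lamDatum F, Dat)`, S1a-C `variationalThm1RegSepCoP7MGB_of_prop8RegSepTopStepGB_of_zero` ∕ k0-s1-w1's 53′, Summits side), (ii) the
C¹ sentence ((9)–(10)), (iii) `hAdm`, (iv) the β-box leaf.  CONDITIONAL — nothing of Bałaban asserted; K0 NOT closed here. [cite: Balaban1985Variational, (6)–(7) p.278, Thm 1 (8)–(10) p.279; Balaban1987RG1, (0.20) p.256, Thm 2 p.259, §1 p.264; Balaban1984PropagatorsII, (2.3) p.224; Balaban1988Convergent, Thm 1 p.262, (2.4)–(2.8) pp.255–256, (2.12)–(2.13) p.256, (2.27)–(2.28) p.259, (2.34)–(2.41) p.261, (3.16)–(3.22) pp.268–269; Balaban1989LargeFieldI, (0.3)–(0.4) p.176] -/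
theorem exists_k0SepCoP_of_thm1RegSepCoP7M_of_thm1C1_of_betaBox (F : T4Family) (hε : 0 < ε₀) (hε' : 0 < ε₂₉) (hB : 0 ≤ B₃) (hB' : 0 ≤ B₃') (ha₀ : 0 < a₀) (ha₁ : 0 < a₁) {Adm : StepGuard F}
    (h15 : VariationalThm1RegSepCoP7MGB F 2 Adm (lamDatum F) (dataSmall7PTopOf F 2) B₃ a₀ a₁) (h15C1 : VariationalThm1C1RegSepCoP7MGB F 2 Adm (lamDatum F) (dataSmall7PTopOf F 2) B₃ B₃' a₀ a₁)
    (hAdm : ∀ (p : B12.RunParams) (n : ℕ) (s : SeqOfRecord F (theta13OfThm1CC1 F 2 ε₀ ε₂₉ B₃ B₃' a₀ a₁).ν (theta13OfThm1CC1 F 2 ε₀ ε₂₉ B₃ B₃' a₀ a₁).τ9.M (gOfRecord₁₃ F 2 (theta13OfThm1CC1 F 2 ε₀ ε₂₉ B₃ B₃' a₀ a₁) p) p.K n), 1 ≤ n → n ≤ p.K →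
      Step.InInterval (theta13OfThm1CC1 F 2 ε₀ ε₂₉ B₃ B₃' a₀ a₁).γ n (gOfRecord₁₃ F 2 (theta13OfThm1CC1 F 2 ε₀ ε₂₉ B₃ B₃' a₀ a₁) p) → PartCompat₁₃ F 2 (theta13OfThm1CC1 F 2 ε₀ ε₂₉ B₃ B₃' a₀ a₁) p n → Adm (theta13OfThm1CC1 F 2 ε₀ ε₂₉ B₃ B₃' a₀ a₁).ν (theta13OfThm1CC1 F 2 ε₀ ε₂₉ B₃ B₃' a₀ a₁).τ9.M (gOfRecord₁₃ F 2 (theta13OfThm1CC1 F 2 ε₀ ε₂₉ B₃ B₃' a₀ a₁) p) p.K n s)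
    {b β' : ℝ} (hb : 0 ≤ b) (hlow : FlowStep.BetaLowerH b (1 / 2) (betaOfRecord₁₃ F 2 (theta13OfThm1CC1 F 2 ε₀ ε₂₉ B₃ B₃' a₀ a₁)))
    (hup : FlowStep.BetaUpperH β' (1 / 2) (betaOfRecord₁₃ F 2 (theta13OfThm1CC1 F 2 ε₀ ε₂₉ B₃ B₃' a₀ a₁))) (hβ' : β' ≤ 3) :
    ∃ θ : Stage13Params F 2, θ.Provisos₁₃SepCoP F 2 ∧ (θ.ZtUnity F 2 ∧ θ.SlotsNondegenerate₁₃ F 2) ∧ θ.Admissible F 2 :=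
  exists_k0SepCoP_of_thm1RegSepCoP7M_of_thm1C1 F hε hε' hB hB' ha₀ ha₁ h15 h15C1 hAdm (hmono_theta13OfThm1CC1_of_betaLowerH hb hlow)
    (hcompRev_theta13OfThm1CC1_of_betaBox hB hB' ha₀.le ha₁.le hb hlow hup hβ')

end FromBothFactsSepCoP

end Literature.MathematicalPhysics.QuantumFieldTheory.Balaban1983to89.Node00

end
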